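import Literature.Analysis.FluidPDE.Seregin2019WeakL3AncientLiouville
import Literature.Analysis.FluidPDE.Seregin2019LimitSlices
import Literature.Analysis.FluidPDE.Seregin2019LimitBounds
import Literature.Analysis.FluidPDE.LocalTypeIBlowup.Compactness
import HarnessLib

/-!
# Seregin 2019, §4 (proof of Prop. 1.3): the compactness passage and the contradiction

Analysis/FluidPDE proofs-only file (theorems only: no definitions, no named facts, no `sorry`),
a tranche of the input `Literature.Analysis.FluidPDE.seregin2019_localWeakL3_epsRegularity`
(`Seregin2019LocalWeakL3.lean`; G. Seregin, arXiv:1906.06707 = St. Petersburg Math. J. 32 (2021)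
565–576, §4). No Navier–Stokes regularity statement is proved here.

The printed proof (§4, pp. 7–8): "let us pass to the limit as `k → ∞`, taking into account
estimates (4.7) and (4.10). Then, after using known compactness arguments, we get the so-called
local energy ancient solution `u` and `p`" with the class bound, the scale-invariant bounds, the
non-triviality `ϱ⁻²∫_{Q(ϱ)}|u|³ ≥ ε⋆/2`, and `u(x,0) = 0`; then (second rescaling, CWY far field,
ESS backward uniqueness) `w ≡ 0` — "This is a contradiction." This file performs that passage
for an abstract **blow-up sequence** `(v_k, q_k)` on the expanding parabolic balls `Q(2ᵐ)`:

* `Seregin2019.false_of_blowupSequence` — if the `k`-th pair is suitable in `Q(2ᵐ)` for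
  `m ≤ k` with level-wise uniform `L³ × L^{3/2}` bounds, the cubic and pressure quantities are
  bounded by `K` at every apex of the closed half-space eventually in `k`, the slices are
  weak-`L³` (`t³|{y ∈ B(a) : t < |v_k(s,y)|}| ≤ M³`) eventually, the top pairings are eventually
  small, and `C(1; 0)[v_k] ≥ κ > 0` eventually, then `False`.

Proof: the tail-tolerant compactness theorem `LocalTypeIBlowup.local_suitableCompactness`
(Albritton–Barker 2019, Lemma 2.2 after Lin 1998, on expanding balls) extracts a limit `(w, π)`
suitable in every `Q(a)`; the bookkeeping files `Seregin2019LimitSlices` / `Seregin2019LimitBounds`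
transfer the weak-`L³` slices, the top vanishing, the apex bounds (hence the uniformly local
dissipation) and the non-triviality to the limit; the endgame
`Seregin2019.lintegral_cube_eq_zero_of_weakL3_ancient_top_vanishing` (restart + Lemarié-Rieusset's
Thm. 15.4, any datum) gives `∫_{Q(1)}|w|³ = 0`, contradicting `C(1;0)[w] ≥ κ`. (One rescaling and
one compactness passage replace the two of print; see `Seregin2019WeakL3AncientLiouville.lean`.)

## References

* G. Seregin, arXiv:1906.06707 (2019), §4, pp. 7–8. [`Seregin2019`]
* D. Albritton, T. Barker, J. Math. Fluid Mech. 21 (2019), Lemma 2.2. [`AlbrittonBarker2019`]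
-/

noncomputable section

open MeasureTheory Set Function Filter Topology TopologicalSpace Metric
open scoped NNReal ENNReal InnerProductSpace RealInnerProductSpace

namespace Literature.Analysis.FluidPDE

namespace Seregin2019

open Literature.Analysis.FunctionSpaces

/-- **The contradiction of Seregin 2019, §4** for an abstract blow-up sequence on the expanding
balls `Q(2ᵐ)` (see the module docstring for the hypotheses and the chain of tree theorems).
[cite: Seregin2019, §4 pp. 7–8 (compactness passage, properties of the limit, "This is a contradiction")] -/
theorem false_of_blowupSequence
    {v : ℕ → ℝ → EuclideanSpace ℝ (Fin 3) → EuclideanSpace ℝ (Fin 3)}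
    {q : ℕ → ℝ → EuclideanSpace ℝ (Fin 3) → ℝ}
    (hball : ∀ (m k : ℕ), m ≤ k → IsSuitableWeakSolutionInBall ((2 : ℝ) ^ m) 0 (v k) (q k))
    (hbd : ∀ m : ℕ, (⨆ k, ⨆ (_ : m ≤ k), (eLpNorm (uncurry (v k)) 3
        (volume.restrict (parabolicCylinder ((2 : ℝ) ^ m) (0 : ℝ × EuclideanSpace ℝ (Fin 3)))) +
      eLpNorm (uncurry (q k)) (3 / 2)
        (volume.restrict (parabolicCylinder ((2 : ℝ) ^ m) (0 : ℝ × EuclideanSpace ℝ (Fin 3)))))) < ∞)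
    {K : ℝ≥0}
    (hC : ∀ z : ℝ × EuclideanSpace ℝ (Fin 3), z.1 ≤ 0 → ∀ ϱ : ℝ, 0 < ϱ →
      ∀ᶠ k in atTop, cknC ϱ z (v k) ≤ K)
    (hD : ∀ z : ℝ × EuclideanSpace ℝ (Fin 3), z.1 ≤ 0 → ∀ ϱ : ℝ, 0 < ϱ →
      ∀ᶠ k in atTop, cknD ϱ z (q k) ≤ K)
    {M : ℝ}
    (hslice : ∀ a : ℝ, 0 < a → ∀ᶠ k in atTop, ∀ s ∈ Ioo (-a ^ 2) (0 : ℝ), ∀ t : ℝ, 0 < t →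
      ENNReal.ofReal (t ^ 3) *
        (volume.restrict (ball (0 : EuclideanSpace ℝ (Fin 3)) a)) {y | t < ‖v k s y‖} ≤
        ENNReal.ofReal (M ^ 3))
    (htop : ∀ φ : EuclideanSpace ℝ (Fin 3) → EuclideanSpace ℝ (Fin 3), ContDiff ℝ (⊤ : ℕ∞) φ →
      HasCompactSupport φ → ∀ ε : ℝ, 0 < ε → ∃ s₁ : ℝ, s₁ < 0 ∧ ∀ᶠ k in atTop,
        ∀ᵐ s ∂(volume.restrict (Ioo s₁ 0)), |∫ y, ⟪v k s y, φ y⟫| ≤ ε)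
    {κ : ℝ} (hκ : 0 < κ) (hnon : ∀ᶠ k in atTop, ENNReal.ofReal κ ≤ cknC 1 0 (v k)) : False := by
  -- ## the compactness passage
  obtain ⟨w, π, σ, hσ, hlim⟩ := LocalTypeIBlowup.local_suitableCompactness hball hbd
  have hσt : Tendsto σ atTop atTop := hσ.tendsto_atTop
  have hw : ∀ a : ℝ, 0 < a → IsSuitableWeakSolutionInBall a (0 : ℝ × EuclideanSpace ℝ (Fin 3)) w π :=
    fun a ha => (hlim a ha).1
  have hw3 : ∀ a : ℝ, 0 < a → MemLp (uncurry w) 3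
      (volume.restrict (parabolicCylinder a (0 : ℝ × EuclideanSpace ℝ (Fin 3)))) :=
    fun a ha => (hlim a ha).2.1
  have hconv := fun a (ha : 0 < a) => (hlim a ha).2.2.1
  have hweakq := fun a (ha : 0 < a) => (hlim a ha).2.2.2
  -- measurability of the subsequence on every `Q(a)` (from suitability in `Q(2ᵐ) ⊇ Q(a)`)
  have hlevel : ∀ a : ℝ, 0 < a → ∃ m : ℕ, a ≤ (2 : ℝ) ^ m := fun a _ => by
    obtain ⟨m, hm⟩ := pow_unbounded_of_one_lt a (by norm_num : (1 : ℝ) < 2)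
    exact ⟨m, hm.le⟩
  have hvm : ∀ a : ℝ, 0 < a → ∀ᶠ j in atTop, AEStronglyMeasurable (uncurry (v (σ j)))
      (volume.restrict (parabolicCylinder a (0 : ℝ × EuclideanSpace ℝ (Fin 3)))) := by
    intro a ha
    obtain ⟨m, hm⟩ := hlevel a ha
    filter_upwards [eventually_ge_atTop m] with j hj
    have hk : m ≤ σ j := hj.trans (hσ.id_le j)
    exact (hball m (σ j) hk).1.distributional.1.aestronglyMeasurable.mono_measure
      (Measure.restrict_mono (parabolicCylinder_mono ha.le hm _) le_rfl)
  have hqm : ∀ a : ℝ, 0 < a → ∀ᶠ j in atTop, AEStronglyMeasurable (uncurry (q (σ j)))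
      (volume.restrict (parabolicCylinder a (0 : ℝ × EuclideanSpace ℝ (Fin 3)))) := by
    intro a ha
    obtain ⟨m, hm⟩ := hlevel a ha
    filter_upwards [eventually_ge_atTop m] with j hj
    have hk : m ≤ σ j := hj.trans (hσ.id_le j)
    exact (hball m (σ j) hk).2.2.2.1.mono_measure
      (Measure.restrict_mono (parabolicCylinder_mono ha.le hm _) le_rfl)
  have hwm : ∀ a : ℝ, 0 < a → AEStronglyMeasurable (uncurry w)
      (volume.restrict (parabolicCylinder a (0 : ℝ × EuclideanSpace ℝ (Fin 3)))) :=
    fun a ha => (hw3 a ha).1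
  have hπ : ∀ a : ℝ, 0 < a → MemLp (uncurry π) (3 / 2)
      (volume.restrict (parabolicCylinder a (0 : ℝ × EuclideanSpace ℝ (Fin 3)))) :=
    fun a ha => (hw a ha).2.2.2
  -- ## properties of the limit
  -- weak-`L³` slices
  have hweak := ae_weakL3_slices_of_tendsto (v := fun j => v (σ j)) hvm hwm hconv
    (fun a ha => hσt.eventually (hslice a ha))
  -- top vanishing
  have htopw : ∀ φ : EuclideanSpace ℝ (Fin 3) → EuclideanSpace ℝ (Fin 3), ContDiff ℝ (⊤ : ℕ∞) φ →
      HasCompactSupport φ → ∀ ε : ℝ, 0 < ε → ∃ s₁ : ℝ, s₁ < 0 ∧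
        ∀ᵐ s ∂(volume.restrict (Ioo s₁ 0)), |∫ y, ⟪w s y, φ y⟫| ≤ ε :=
    fun φ hφ hφc ε hε => top_vanishing_of_tendsto (v := fun j => v (σ j)) hvm hw3 hconv
      (fun φ hφ hφc ε hε => by
        obtain ⟨s₁, hs₁, hev⟩ := htop φ hφ hφc ε hε
        exact ⟨s₁, hs₁, hσt.eventually hev⟩) hφ hφc hε
  -- apex bounds
  have hCw : ∀ z : ℝ × EuclideanSpace ℝ (Fin 3), z.1 ≤ 0 → ∀ ϱ : ℝ, 0 < ϱ → cknC ϱ z w ≤ K :=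
    fun z hz ϱ hϱ => cknC_le_of_tendsto_eventually (v := fun j => v (σ j)) hvm hwm hconv hz hϱ
      (hσt.eventually (hC z hz ϱ hϱ))
  have hDπ : ∀ z : ℝ × EuclideanSpace ℝ (Fin 3), z.1 ≤ 0 → ∀ ϱ : ℝ, 0 < ϱ → cknD ϱ z π ≤ K :=
    fun z hz ϱ hϱ => cknD_le_of_tendsto_weakly_eventually (q := fun j => q (σ j)) hqm hπ hweakq hz hϱ
      (hσt.eventually (hD z hz ϱ hϱ))
  -- uniformly local dissipation
  have hG := exists_weakGradient_uniform_dissipation_of_bounds hw hCw hDπ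
  -- ## the endgame: `∫_{Q(1)} |w|³ = 0`
  have hW : (64 : ℝ≥0∞) * ENNReal.ofReal (M ^ 3) ≠ ∞ := ENNReal.mul_ne_top (by norm_num) ENNReal.ofReal_ne_top
  have hzero := lintegral_cube_eq_zero_of_weakL3_ancient_top_vanishing hW hw hw3 hweak hG htopw one_pos
  -- ## non-triviality of the limit: `κ ≤ C(1;0)[w] = 0`
  have hle : ENNReal.ofReal κ ≤ cknC 1 0 w :=
    le_cknC_of_tendsto_eventually (v := fun j => v (σ j)) one_pos Subset.rfl (hvm 1 one_pos)
      (hwm 1 one_pos) (hconv 1 one_pos) (hσt.eventually hnon)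
  rw [cknC, hzero, mul_zero, nonpos_iff_eq_zero, ENNReal.ofReal_eq_zero] at hle
  linarith

end Seregin2019

end Literature.Analysis.FluidPDE

end
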